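import Literature.AlgebraicTopology.CharacteristicClasses.TopChernNumberLocalization
import Literature.AlgebraicTopology.CharacteristicClasses.LineEulerNumberLocalModel
import Literature.AlgebraicTopology.CharacteristicClasses.ProjectiveBundleLerayHirsch
import Literature.AlgebraicTopology.CharacteristicClasses.ProjectiveSpaceCohomologyFacts
import Literature.AlgebraicTopology.CharacteristicClasses.ProjectiveLerayHirsch
import Mathlib.Topology.Homotopy.Contractible
import HarnessLib

/-!
# The relative Thom class of `P(E ⊕ ℂ)` over a small trivialised set is the model class (every rank)

J. Milnor, J. Stasheff, *Characteristic Classes* (1974), §9 Thm. 9.1 and §10 Thm. 10.2 / 10.4: the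
Thom class `u ∈ Hⁿ(E, E₀)` of an oriented `n`-plane bundle restricts, over a trivialising set `U`, to
the pull-back of the preferred generator of the fibre pair `(F, F₀)` along the projection
`E|_U ≅ U × F → F`; D. Husemoller, *Fibre Bundles* (3rd ed. 1994), Ch. 17 §2 (2.3) and Def. 2.1
(`H*(ℂPᵏ)` and the local product structure of a projective bundle); A. Hatcher, *Algebraic Topology*
(2002), Ch. 0 Example 0.6 (`ℂPᵏ` minus a point deformation retracts onto `ℂPᵏ⁻¹`), Thm. 3.12
(`H^odd(ℂPᵏ) = 0`), §3.1 pp. 199–201 (exact sequence of the pair, homotopy invariance).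

The rank-one file `LineEulerNumberLocalModel` identified the relative Thom class `t̃ ∈ H²(D, D ∖ s₀B)`
of a LINE bundle over a trivialising set with the model generator, using that the model vector part
`ℙ(F ⊕ ℂ) ∖ [0 : 1]` is contractible for a line `F`.  This file does the same in EVERY rank `k`, for
the Thom class `t_E = Σ q̂^* c_{k-i}(E) ⌣ yⁱ ∈ H²ᵏ(P(E ⊕ ℂ))` of `CompletionThomClass` and its chosen
relative lift `t̃_E` (`CompletionThomClassVectorPart`), with INTEGER coefficients:

* `isZero_singularCohomology_modelVectorPart_int` — for `dim F = k ≥ 1` the model vector part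
  `ℙ(F ⊕ ℂ) ∖ [0 : 1]` has `Hⁱ(·; ℤ) = 0` unless `i` is even and `≤ 2k - 2`: it deformation retracts
  onto the hyperplane at infinity `{[w : 0]} ≅ ℙ(F) = ℂPᵏ⁻¹` (`rangeLocusHomotopyEquiv`,
  `rangeLocusHomeomorph`, `isZero_singularCohomology_projectivization`); hence relative lifts to
  `H²ᵏ(ℙ, ℙ ∖ [0 : 1]; ℤ)` are unique (`toAbsolute_modelVectorPart_injective_int`) and exist;
* `omegaK`, `omegaRelK`, `omegaRelVecK` — **the model classes**: `ω_k = xᵏ ∈ H²ᵏ(ℙ(F ⊕ ℂ))`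
  (`xpow`, `x = e(γ¹)`), its unique relative lift `ω_k^rel ∈ H²ᵏ(ℙ, ℙ ∖ [0 : 1]; ℤ)` and the vector
  model `ω_k^rel,vec = α^* ω_k^rel ∈ H²ᵏ(F, F ∖ 0; ℤ)` (`α u = [u : 1]`; Milnor–Stasheff's preferred
  generator `u|(F, F₀)` up to the tree's normalisations);
* `toAbsolute_prodVectorPart_injective_int` — on `W × ℙ(F ⊕ ℂ)` with `W` CONTRACTIBLE, relative lifts
  on `(W × ℙ, W × (ℙ ∖ [0 : 1]))` are unique in degree `2k` (`H²ᵏ⁻¹(W × ℙ₀; ℤ) = 0`);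
* `map_projOverIncl_complThomClass` — **`t_E|_{D_W} = h^*(pr₂^* ω_k)`** for `W ⊆ K ⊆ U_i`, `K` closed,
  `W` contractible: `y|_{D_W} = h^* pr₂^* x` exactly (`resCls_lineEuler_eq` for the completed bundle,
  `h = projOverHomeomorph`), and the terms `q̂^* c_j(E)`, `j ≥ 1`, die on `D_W` because `H^{2j}(W) = 0`;
* `relComplThomClassOn_eq_model` — **`t̃_E|_{(D_W, vector part)} = (pr₂ ∘ h)^* ω_k^rel`** (both lift
  the same class; lifts are unique over contractible `W`);
* `localIndex_eq_modelSectionK`, `localIndex_eq_vecSectionK` — consequently the LOCAL INDEX of a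
  section `s` at an isolated zero `p ∈ W` (`TopChernNumberLocalization.localIndex`, over `ℤ`) is

    `ind_p(s) = ⟨(b ↦ [e_b(s b) : 1])^* ω_k^rel, μ_p⟩ = ⟨ω_k^rel,vec, (b ↦ e_b(s b))_* μ_p⟩`,

  the relative Kronecker pairing on `(W, W ∖ p)` of the model class pulled back along the section
  READ IN THE TRIVIALISATION `e = trivializationAt i` — McDuff–Salamon's "local degree of `s` at `p`"
  (Thm. 2.7.5 / Ex. 4.4.3 (v)) in homological form, every rank.

Everything is proved; no named facts.

## References

* J. Milnor, J. Stasheff, *Characteristic Classes*, Ann. of Math. Stud. 76, PUP 1974, §9 Thm. 9.1,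
  §10 Thm. 10.2 and Thm. 10.4. [MilnorStasheff1974]
* D. Husemoller, *Fibre Bundles*, 3rd ed., GTM 20, Springer 1994, Ch. 17 §2 (2.3), Def. 2.1.
  [HusemollerFibreBundles1994]
* A. Hatcher, *Algebraic Topology*, CUP 2002, Ch. 0 Example 0.6, Thm. 3.12, §3.1 pp. 199–201.
  [HatcherAT2002]
* D. McDuff, D. Salamon, *Introduction to Symplectic Topology*, 3rd ed., OUP 2017, Thm. 2.7.5,
  Ex. 4.4.3 (v). [McDuffSalamon2017]
-/

noncomputable section

open CategoryTheory Limits Function Set Bundle Topology Module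
  Literature.AlgebraicTopology.SingularHomology
open scoped LinearAlgebra.Projectivization

namespace Literature.AlgebraicTopology.CharacteristicClasses

/-! ### Contractible factors do not change cohomology -/

section Contractible

variable (W : Type) [TopologicalSpace W] [ContractibleSpace W]

/-- `W × X ≃ₕ X` for contractible `W`. [cite: HatcherAT2002, Ch. 0 p. 4] -/
def prodContractibleHomotopyEquiv (X : Type) [TopologicalSpace X] : ContinuousMap.HomotopyEquiv (W × X) X :=
  (((ContractibleSpace.hequiv_unit W).some).prodCongr (ContinuousMap.HomotopyEquiv.refl X)).trans
    (Homeomorph.punitProd X).toHomotopyEquiv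

/-- **`Hⁱ(W × X; M) = 0` whenever `Hⁱ(X; M) = 0`, for contractible `W`** (homotopy invariance).
[cite: HatcherAT2002, §3.1 p. 201] -/
theorem isZero_singularCohomology_prod_of_contractible (R : Type) [CommRing R] (M : Type) [AddCommGroup M] [Module R M]
    (X : Type) [TopologicalSpace X] {i : ℕ} (hX : IsZero (singularCohomology R M X i)) :
    IsZero (singularCohomology R M (W × X) i) :=
  hX.of_iso (singularCohomology.isoOfHomotopyEquiv' R M (prodContractibleHomotopyEquiv W X) i).symm

end Contractible

/-! ### The model vector part `ℙ(F ⊕ ℂ) ∖ [0 : 1]` in rank `k`: cohomology of `ℂPᵏ⁻¹` -/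

section ModelPart

variable (F : Type) [NormedAddCommGroup F] [NormedSpace ℂ F] [FiniteDimensional ℂ F]
  {k : ℕ} (hF : finrank ℂ F = k) (hk : 1 ≤ k)

omit [FiniteDimensional ℂ F] in
/-- The range of `(w, z) ↦ (w, 0)` is the range of `w ↦ (w, 0)`. [folklore] -/
theorem range_fstProj_eq : LinearMap.range ((fstProj F : F × ℂ →L[ℂ] F × ℂ) : F × ℂ →ₗ[ℂ] F × ℂ) =
    LinearMap.range (LinearMap.inl ℂ F ℂ) := by
  ext w
  constructor
  · rintro ⟨v, rfl⟩
    exact ⟨v.1, rfl⟩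
  · rintro ⟨u, rfl⟩
    exact ⟨(u, 0), rfl⟩

omit [FiniteDimensional ℂ F] in
include hF in
/-- `dim range((w, z) ↦ (w, 0)) = dim F = k`. [folklore] -/
theorem finrank_range_fstProj : finrank ℂ ↥(LinearMap.range ((fstProj F : F × ℂ →L[ℂ] F × ℂ) : F × ℂ →ₗ[ℂ] F × ℂ)) = k := by
  rw [range_fstProj_eq, LinearMap.finrank_range_of_inj LinearMap.inl_injective, hF]

include hF hk in
/-- **`Hⁱ(ℙ(F ⊕ ℂ) ∖ [0 : 1]; ℤ) = 0` unless `i` is even and `i ≤ 2k - 2`** (`dim F = k ≥ 1`): the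
model vector part is the chart of the projection `(w, z) ↦ (w, 0)`, which deformation retracts onto
its range locus `{[w : 0]} ≅ ℙ(F) = ℂPᵏ⁻¹` (Hatcher, Example 0.6), whose integral cohomology is
concentrated in even degrees `≤ 2k - 2` (Thm. 3.12). [cite: HatcherAT2002, Ch. 0 Example 0.6 and Thm. 3.12] -/
theorem isZero_singularCohomology_modelVectorPart_int {i : ℕ} (hi : ¬(Even i ∧ i ≤ 2 * (k - 1))) :
    IsZero (singularCohomology ℤ ℤ ↥(modelVectorPart F) i) := by
  set P : F × ℂ →L[ℂ] F × ℂ := fstProj F with hP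
  have hPP : ∀ v, P (P v) = P v := fstProj_idem F
  haveI : FiniteDimensional ℂ ↥(LinearMap.range (P : F × ℂ →ₗ[ℂ] F × ℂ)) := inferInstance
  have hdim : finrank ℂ ↥(LinearMap.range (P : F × ℂ →ₗ[ℂ] F × ℂ)) = (k - 1) + 1 := by
    rw [hP, finrank_range_fstProj F hF]; omega
  -- `H(ℙ(range P)) = 0`
  have h0 : IsZero (singularCohomology ℤ ℤ (ℙ ℂ ↥(LinearMap.range (P : F × ℂ →ₗ[ℂ] F × ℂ))) i) :=
    isZero_singularCohomology_projectivization hdim hi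
  -- transport along `ℙ(range P) ≅ rangeLocus P ≃ₕ projChart P = model vector part`
  have h1 : IsZero (singularCohomology ℤ ℤ ↥(rangeLocus P) i) :=
    h0.of_iso (singularCohomology.mapIso ℤ ℤ (rangeLocusHomeomorph P hPP) i)
  have h2 : IsZero (singularCohomology ℤ ℤ ↥(projChart P) i) :=
    h1.of_iso (singularCohomology.isoOfHomotopyEquiv' ℤ ℤ (rangeLocusHomotopyEquiv P hPP) i)
  rw [modelVectorPart_eq_projChart]
  exact h2

include hF hk in
/-- `H²ᵏ⁻¹(ℙ(F ⊕ ℂ) ∖ [0 : 1]; ℤ) = 0`. [cite: HatcherAT2002, Thm. 3.12] -/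
theorem isZero_singularCohomology_modelVectorPart_int_odd :
    IsZero (singularCohomology ℤ ℤ ↥(modelVectorPart F) (2 * k - 1)) :=
  isZero_singularCohomology_modelVectorPart_int F hF hk fun ⟨he, _⟩ ↦ by
    rcases he with ⟨r, hr⟩; omega

include hF hk in
/-- `H²ᵏ(ℙ(F ⊕ ℂ) ∖ [0 : 1]; ℤ) = 0`. [cite: HatcherAT2002, Thm. 3.12] -/
theorem isZero_singularCohomology_modelVectorPart_int_top :
    IsZero (singularCohomology ℤ ℤ ↥(modelVectorPart F) (2 * k)) :=
  isZero_singularCohomology_modelVectorPart_int F hF hk fun ⟨_, hle⟩ ↦ by omega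

include hF hk in
/-- **Relative lifts to `H²ᵏ(ℙ(F ⊕ ℂ), ℙ ∖ [0 : 1]; ℤ)` are unique**: `H²ᵏ(ℙ, ℙ₀) → H²ᵏ(ℙ)` is
one-to-one (`H²ᵏ⁻¹(ℙ₀) = 0`). [cite: HatcherAT2002, §3.1 p. 200] -/
theorem toAbsolute_modelVectorPart_injective_int :
    Injective (relSingularCohomology.toAbsolute ℤ ℤ (ℙ ℂ (F × ℂ)) (modelVectorPart F) (2 * k)) := by
  obtain ⟨k', rfl⟩ : ∃ k', k = k' + 1 := ⟨k - 1, by omega⟩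
  rw [show 2 * (k' + 1) = (2 * k' + 1) + 1 by ring]
  refine toAbsolute_injective_of_map_subsetIncl_surjective (2 * k' + 1) fun y ↦ ⟨0, ?_⟩
  have h := isZero_singularCohomology_modelVectorPart_int_odd F hF hk
  rw [show 2 * (k' + 1) - 1 = 2 * k' + 1 by omega] at h
  haveI := ModuleCat.subsingleton_of_isZero h
  exact Subsingleton.elim _ _

/-! ### The model classes `ω_k`, `ω_k^rel`, `ω_k^rel,vec` -/

/-- **The model class `ω_k = xᵏ ∈ H²ᵏ(ℙ(F ⊕ ℂ); R)`**, `x = e(γ¹)` the Euler class of the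
tautological line bundle (Husemoller (2.3): `H*(ℂPᵏ)` is free on `1, x, …, xᵏ`; the fibre value of the
Thom class `t_E = yᵏ + …`). [cite: HusemollerFibreBundles1994, Ch. 17 §2 (2.3)] -/
abbrev omegaK (R : Type) [CommRing R] (k : ℕ) : singularCohomology R R (ℙ ℂ (F × ℂ)) (2 * k) := xpow R (F × ℂ) k

include hF hk in
/-- `ω_k` dies on the model vector part (`H²ᵏ(ℙ₀; ℤ) = 0`). [cite: HatcherAT2002, Thm. 3.12] -/
theorem map_subsetIncl_omegaK_eq_zero :
    singularCohomology.map ℤ ℤ (subsetIncl (modelVectorPart F)) (2 * k) (omegaK F ℤ k) = 0 :=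
  haveI := ModuleCat.subsingleton_of_isZero (isZero_singularCohomology_modelVectorPart_int_top F hF hk)
  Subsingleton.elim _ _

include hF hk in
/-- A relative lift of `ω_k` exists. [cite: HatcherAT2002, §3.1 p. 200] -/
theorem exists_omegaRelK : ∃ x : relSingularCohomology ℤ ℤ (ℙ ℂ (F × ℂ)) (modelVectorPart F) (2 * k),
    relSingularCohomology.toAbsolute ℤ ℤ (ℙ ℂ (F × ℂ)) (modelVectorPart F) (2 * k) x = omegaK F ℤ k := by
  have hex := relSingularCohomology.exact_toAbsolute_map (R := ℤ) (M := ℤ) (X := ℙ ℂ (F × ℂ)) (modelVectorPart F) (2 * k)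
  rw [ShortComplex.moduleCat_exact_iff] at hex
  exact hex (omegaK F ℤ k) (map_subsetIncl_omegaK_eq_zero F hF hk)

/-- **The relative model class `ω_k^rel ∈ H²ᵏ(ℙ(F ⊕ ℂ), ℙ ∖ [0 : 1]; ℤ)`**: THE lift of `ω_k = xᵏ`
(Milnor–Stasheff's `u|(F, F₀)` in the projective model, every rank). [cite: MilnorStasheff1974, §9 Thm. 9.1] -/
def omegaRelK : relSingularCohomology ℤ ℤ (ℙ ℂ (F × ℂ)) (modelVectorPart F) (2 * k) :=
  (exists_omegaRelK F hF hk).choose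

/-- `ω_k^rel` lifts `ω_k`. [cite: MilnorStasheff1974, §9 Thm. 9.1] -/
theorem toAbsolute_omegaRelK :
    relSingularCohomology.toAbsolute ℤ ℤ (ℙ ℂ (F × ℂ)) (modelVectorPart F) (2 * k) (omegaRelK F hF hk) = omegaK F ℤ k :=
  (exists_omegaRelK F hF hk).choose_spec

variable {F} in
/-- Uniqueness of `ω_k^rel`. [folklore] -/
theorem eq_omegaRelK_of_toAbsolute_eq {x : relSingularCohomology ℤ ℤ (ℙ ℂ (F × ℂ)) (modelVectorPart F) (2 * k)}
    (hx : relSingularCohomology.toAbsolute ℤ ℤ (ℙ ℂ (F × ℂ)) (modelVectorPart F) (2 * k) x = omegaK F ℤ k) :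
    x = omegaRelK F hF hk :=
  toAbsolute_modelVectorPart_injective_int F hF hk (hx.trans (toAbsolute_omegaRelK F hF hk).symm)

/-- **The vector model class `ω_k^rel,vec = α^* ω_k^rel ∈ H²ᵏ(F, F ∖ 0; ℤ)`** along `α u = [u : 1]`
(Milnor–Stasheff's preferred generator of the fibre pair, up to the tree's normalisation).
[cite: MilnorStasheff1974, §9 Thm. 9.1] -/
def omegaRelVecK : relSingularCohomology ℤ ℤ F ({0}ᶜ : Set F) (2 * k) :=
  relSingularCohomology.map ℤ ℤ (vecEmbed F) (mapsTo_vecEmbed F) (2 * k) (omegaRelK F hF hk)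

end ModelPart

/-! ### Products with a contractible space: relative lifts are unique -/

section Product

variable (F : Type) [NormedAddCommGroup F] [NormedSpace ℂ F] [FiniteDimensional ℂ F]
  {k : ℕ} (hF : finrank ℂ F = k) (hk : 1 ≤ k) (W : Type) [TopologicalSpace W]

omit [FiniteDimensional ℂ F] in
/-- `W × (ℙ ∖ [0 : 1]) ≅ (vertical vector part of W × ℙ)`. [folklore] -/
def prodVectorPartHomeomorph : ↥(prodVectorPart F W) ≃ₜ W × ↥(modelVectorPart F) where
  toFun q := (q.1.1, ⟨q.1.2, q.2⟩)
  invFun q := ⟨(q.1, (q.2 : ℙ ℂ (F × ℂ))), q.2.2⟩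
  left_inv _ := rfl
  right_inv _ := rfl
  continuous_toFun := (continuous_fst.comp continuous_subtype_val).prodMk
    ((continuous_snd.comp continuous_subtype_val).subtype_mk _)
  continuous_invFun := (continuous_fst.prodMk (continuous_subtype_val.comp continuous_snd)).subtype_mk _

include hF hk in
/-- **Relative lifts on `(W × ℙ(F ⊕ ℂ), W × (ℙ ∖ [0 : 1]))` are unique in degree `2k` for contractible
`W`**: `H²ᵏ⁻¹(W × ℙ₀; ℤ) ≅ H²ᵏ⁻¹(ℙ₀; ℤ) = 0`. [cite: HatcherAT2002, §3.1 pp. 200–201] -/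
theorem toAbsolute_prodVectorPart_injective_int [ContractibleSpace W] :
    Injective (relSingularCohomology.toAbsolute ℤ ℤ (W × ℙ ℂ (F × ℂ)) (prodVectorPart F W) (2 * k)) := by
  obtain ⟨k', rfl⟩ : ∃ k', k = k' + 1 := ⟨k - 1, by omega⟩
  rw [show 2 * (k' + 1) = (2 * k' + 1) + 1 by ring]
  refine toAbsolute_injective_of_map_subsetIncl_surjective (2 * k' + 1) fun y ↦ ⟨0, ?_⟩
  have h := isZero_singularCohomology_modelVectorPart_int_odd F hF hk
  rw [show 2 * (k' + 1) - 1 = 2 * k' + 1 by omega] at h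
  have h' : IsZero (singularCohomology ℤ ℤ ↥(prodVectorPart F W) (2 * k' + 1)) :=
    (isZero_singularCohomology_prod_of_contractible W ℤ ℤ ↥(modelVectorPart F) h).of_iso
      (singularCohomology.mapIso ℤ ℤ (prodVectorPartHomeomorph F W).symm (2 * k' + 1))
  haveI := ModuleCat.subsingleton_of_isZero h'
  exact Subsingleton.elim _ _

end Product

/-! ### The completed bundle over a small trivialised set -/

namespace ComplexVectorBundle

variable {B : Type} [TopologicalSpace B] (E : ComplexVectorBundle.{0, 0} B)

section OverW

variable (i : B) {K W : Set B}

/-- `K ⊆ U_i` for the completed bundle `E ⊕ ℂ` (same base sets). [folklore] -/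
theorem subset_baseSet_compl_triv (hK : K ⊆ (E.triv i).baseSet) : K ⊆ (E.compl.triv i).baseSet :=
  fun b hb ↦ ⟨hK hb, mem_univ b⟩

/-- **The local product structure `h : D_W = P(E ⊕ ℂ)|_W ≃ₜ W × ℙ(F ⊕ ℂ)`** of the atlas
trivialisation `e_i × 𝟙` (`projOverHomeomorph` of the completed bundle). [cite: HusemollerFibreBundles1994, Ch. 17 Def. 2.1] -/
abbrev complOverHomeomorph (hK : K ⊆ (E.triv i).baseSet) (hW : W ⊆ K) : ↥(E.compl.projMap ⁻¹' W) ≃ₜ ↥W × ℙ ℂ (E.F × ℂ) :=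
  projOverHomeomorph (E := E.compl) i (E.subset_baseSet_compl_triv i hK) hW

variable (hK : K ⊆ (E.triv i).baseSet) (hKc : IsClosed K) (hW : W ⊆ K)

omit hW in
/-- `(e_b w₁, w₂) ≠ 0` for `w ≠ 0` in `E_b ⊕ ℂ`. [folklore] -/
theorem linEquivAt_compl_ne_zero (b : B) {w : E.compl.E b} (hw : w ≠ 0) :
    ((linEquivAt ℂ E.F E.E (E.triv i) b w.1, w.2) : E.F × ℂ) ≠ 0 := by
  intro h0
  rw [Prod.mk_eq_zero] at h0
  apply hw
  have h1 : w.1 = 0 := (linEquivAt ℂ E.F E.E (E.triv i) b).injective ((h0.1).trans (map_zero _).symm)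
  exact Prod.ext h1 h0.2

/-- **`h` on the fibre over `b ∈ W`: `⟨b, [v : t]⟩ ↦ (b, [e_b v : t])`.** [cite: HusemollerFibreBundles1994, Ch. 17 Def. 2.1] -/
theorem complOverHomeomorph_snd_mk {b : B} (hb : b ∈ W) (w : E.compl.E b) (hw : w ≠ 0) :
    (E.complOverHomeomorph i hK hW ⟨⟨b, Projectivization.mk ℂ w hw⟩, hb⟩).2 =
      Projectivization.mk ℂ ((linEquivAt ℂ E.F E.E (E.triv i) b w.1, w.2) : E.F × ℂ) (E.linEquivAt_compl_ne_zero i b hw) := by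
  refine (projOverHomeomorph_snd (E := E.compl) i (E.subset_baseSet_compl_triv i hK) hW
    ⟨⟨b, Projectivization.mk ℂ w hw⟩, hb⟩).trans ?_
  rw [lineIn_eq_homeomorph]
  change homeomorphOfContinuousLinearEquiv (ContinuousLinearEquiv.refl ℂ (E.F × ℂ))
    (complTriv (E.triv i) ⟨b, Projectivization.mk ℂ w hw⟩).2 = _
  rw [complTriv_apply (E.triv i) (hK (hW hb))]
  rfl

/-- The first component of `h` is the base point. [folklore] -/
theorem complOverHomeomorph_fst (q : ↥(E.compl.projMap ⁻¹' W)) : ((E.complOverHomeomorph i hK hW q).1 : B) = q.1.proj :=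
  congrArg Subtype.val (fst_projOverHomeomorph (E := E.compl) i (E.subset_baseSet_compl_triv i hK) hW q)

/-- **The vector part of `D_W`**: `D_W ∩ (D ∖ s₀(B))`. [folklore] -/
abbrev vectorPartOver (W : Set B) : Set ↥(E.compl.projMap ⁻¹' W) := Subtype.val ⁻¹' vectorPart E.F E.E

/-- **`h` matches the vector parts**: the fibre coordinate of `h q` is off `[0 : 1]` iff `q` is in the
vector part. [folklore] -/
theorem complOverHomeomorph_snd_mem_iff (q : ↥(E.compl.projMap ⁻¹' W)) :
    (E.complOverHomeomorph i hK hW q).2 ∈ modelVectorPart (E.F) ↔ q.1 ∈ vectorPart E.F E.E := by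
  obtain ⟨⟨b, ℓ⟩, hb⟩ := q
  change b ∈ W at hb
  induction ℓ using Projectivization.ind with
  | h w hw =>
    rw [E.complOverHomeomorph_snd_mk i hK hW hb w hw, mk_mem_modelVectorPart_iff]
    obtain ⟨v, t⟩ := w
    change _ ↔ (⟨b, Projectivization.mk ℂ ((v, t) : E.E b × ℂ) hw⟩ : ProjCompl E.F E.E) ∈ vectorPart E.F E.E
    rw [mk_mem_vectorPart_iff]
    exact (linEquivAt ℂ E.F E.E (E.triv i) b).map_ne_zero_iff

/-- `h` is a map of pairs (vector parts). [folklore] -/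
theorem mapsTo_complOverHomeomorph :
    MapsTo (E.complOverHomeomorph i hK hW : C(↥(E.compl.projMap ⁻¹' W), ↥W × ℙ ℂ (E.F × ℂ)))
      (E.vectorPartOver W) (prodVectorPart E.F ↥W) :=
  fun q hq ↦ (E.complOverHomeomorph_snd_mem_iff i hK hW q).2 hq

/-- `h⁻¹` is a map of pairs (vector parts). [folklore] -/
theorem mapsTo_complOverHomeomorph_symm :
    MapsTo ((E.complOverHomeomorph i hK hW).symm : C(↥W × ℙ ℂ (E.F × ℂ), ↥(E.compl.projMap ⁻¹' W)))
      (prodVectorPart E.F ↥W) (E.vectorPartOver W) := by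
  intro q hq
  have h := (E.complOverHomeomorph_snd_mem_iff i hK hW ((E.complOverHomeomorph i hK hW).symm q)).1
  rw [Homeomorph.apply_symm_apply] at h
  exact h hq

/-- `pr₂ ∘ h` is a map of pairs `(D_W, vector part) → (ℙ(F ⊕ ℂ), ℙ ∖ [0 : 1])`. [folklore] -/
theorem mapsTo_snd_comp_complOverHomeomorph :
    MapsTo ((ContinuousMap.snd : C(↥W × ℙ ℂ (E.F × ℂ), ℙ ℂ (E.F × ℂ))).comp
      (E.complOverHomeomorph i hK hW : C(↥(E.compl.projMap ⁻¹' W), ↥W × ℙ ℂ (E.F × ℂ))))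
      (E.vectorPartOver W) (modelVectorPart E.F) :=
  fun q hq ↦ (E.complOverHomeomorph_snd_mem_iff i hK hW q).2 hq

/-- The inclusion `D_W ↪ D` is a map of pairs (vector parts). [folklore] -/
theorem mapsTo_subsetIncl_projMap_preimage (W : Set B) :
    MapsTo (subsetIncl (E.compl.projMap ⁻¹' W)) (E.vectorPartOver W) (vectorPart E.F E.E) := fun _ hq ↦ hq

variable [T2Space B] [ParacompactSpace B]

/-! ### `t_E|_{D_W} = h^* pr₂^* ω_k` -/

include hKc in
/-- **Over a contractible `W ⊆ K ⊆ U_i` (`K` closed) the Thom class IS the model class: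
`t_E|_{D_W} = h^*(pr₂^* ω_k)`**, `ω_k = xᵏ`.  Indeed `y|_{D_W} = h^*(pr₂^* x)` (`resCls_lineEuler_eq` for
`E ⊕ ℂ`), so `yᵏ|_{D_W} = h^* pr₂^* xᵏ`, and every other term `q̂^* c_j(E) ⌣ y^{k-j}` (`j ≥ 1`) of `t_E`
restricts to `q_W^*(c_j(E)|_W) ⌣ … = 0` since `H^{2j}(W) = 0` (Milnor–Stasheff Thm. 10.4: over a
trivialising set the Thom class is pulled back from the fibre). [cite: MilnorStasheff1974, §10 Thm. 10.4] -/
theorem map_projOverIncl_complThomClass [ContractibleSpace ↥W] :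
    singularCohomology.map ℤ ℤ (subsetIncl (E.compl.projMap ⁻¹' W)) (2 * E.rank) (E.complThomClass ℤ) =
      singularCohomology.map ℤ ℤ (E.complOverHomeomorph i hK hW : C(↥(E.compl.projMap ⁻¹' W), ↥W × ℙ ℂ (E.F × ℂ)))
        (2 * E.rank) (singularCohomology.map ℤ ℤ (ContinuousMap.snd : C(↥W × ℙ ℂ (E.F × ℂ), ℙ ℂ (E.F × ℂ))) (2 * E.rank)
          (omegaK E.F ℤ E.rank)) := by
  set u : C(↥(E.compl.projMap ⁻¹' W), E.compl.Proj) := subsetIncl (E.compl.projMap ⁻¹' W) with hu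
  set qW : C(↥(E.compl.projMap ⁻¹' W), ↥W) :=
    ⟨fun q ↦ ⟨E.compl.projMap q.1, q.2⟩, (E.compl.projMap.continuous.comp continuous_subtype_val).subtype_mk _⟩ with hqW
  have hsq : E.compl.projMap.comp u = (subsetIncl W).comp qW := rfl
  -- `u^* y = h^* pr₂^* x`
  have hy : singularCohomology.map ℤ ℤ u 2 (E.yClass ℤ) =
      singularCohomology.map ℤ ℤ (E.complOverHomeomorph i hK hW : C(↥(E.compl.projMap ⁻¹' W), ↥W × ℙ ℂ (E.F × ℂ))) 2
        (singularCohomology.map ℤ ℤ (ContinuousMap.snd : C(↥W × ℙ ℂ (E.F × ℂ), ℙ ℂ (E.F × ℂ))) 2 (tautEuler (E.F × ℂ) ℤ 1)) :=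
    resCls_lineEuler_eq (E := E.compl) (E.compl.k0 E.rank_compl_pos) ℤ i (E.subset_baseSet_compl_triv i hK) hKc hW
  -- the Chern class terms die on `W`
  have hc : (fun j : Fin E.rank ↦ singularCohomology.map ℤ ℤ (subsetIncl W) (2 * (E.rank - (j : ℕ))) (E.chernClassR ℤ (E.rank - (j : ℕ)))) =
      fun j ↦ 0 := by
    funext j
    exact eq_zero_of_contractible (by have := j.isLt; omega) _
  rw [complThomClass, map_add, map_cupPow, hy,
    map_lhSum ℤ qW E.compl.projMap u (subsetIncl W) hsq _ (E.yClass ℤ) rfl, hc]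
  have h0 : lhSum ℤ qW (singularCohomology.map ℤ ℤ u 2 (E.yClass ℤ)) (K := 2 * E.rank) (fun j : Fin E.rank ↦ 2 * (E.rank - (j : ℕ)))
      (fun j ↦ by have := j.isLt; omega) (fun _ ↦ 0) = 0 := by
    have h2 := lhSum_add ℤ qW (singularCohomology.map ℤ ℤ u 2 (E.yClass ℤ)) (K := 2 * E.rank)
      (fun j : Fin E.rank ↦ 2 * (E.rank - (j : ℕ))) (fun j ↦ by have := j.isLt; omega) (fun _ ↦ 0) (fun _ ↦ 0)
    rw [show ((fun _ : Fin E.rank ↦ (0 : singularCohomology ℤ ℤ ↥W (2 * (E.rank - _)))) + fun _ ↦ 0) = fun _ ↦ 0 from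
      funext fun _ ↦ add_zero _] at h2
    simpa using h2.symm
  rw [h0, add_zero, ← map_cupPow, ← map_cupPow]
  rfl

/-! ### The relative Thom class over `W` is the model class -/

/-- **The relative Thom class over `W`**: `t̃_E|_{(D_W, vector part)}`. [cite: MilnorStasheff1974, §10 Thm. 10.4] -/
def relComplThomClassOn (hE : 0 < E.rank) (W : Set B) :
    relSingularCohomology ℤ ℤ ↥(E.compl.projMap ⁻¹' W) (E.vectorPartOver W) (2 * E.rank) :=
  relSingularCohomology.map ℤ ℤ (subsetIncl (E.compl.projMap ⁻¹' W)) (E.mapsTo_subsetIncl_projMap_preimage W) (2 * E.rank)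
    (E.relComplThomClass ℤ hE)

/-- `t̃_E|_W` lifts `t_E|_{D_W}`. [folklore] -/
theorem toAbsolute_relComplThomClassOn (hE : 0 < E.rank) (W : Set B) :
    relSingularCohomology.toAbsolute ℤ ℤ ↥(E.compl.projMap ⁻¹' W) (E.vectorPartOver W) (2 * E.rank) (E.relComplThomClassOn hE W) =
      singularCohomology.map ℤ ℤ (subsetIncl (E.compl.projMap ⁻¹' W)) (2 * E.rank) (E.complThomClass ℤ) := by
  rw [relComplThomClassOn, ← ModuleCat.comp_apply, relSingularCohomology.map_comp_toAbsolute, ModuleCat.comp_apply,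
    toAbsolute_relComplThomClass]

/-- **The model relative Thom class over `W`**: `(pr₂ ∘ h)^* ω_k^rel`. [cite: MilnorStasheff1974, §10 Thm. 10.2] -/
def modelRelComplThomClassOn (hK' : finrank ℂ E.F = E.rank) (hE : 1 ≤ E.rank) :
    relSingularCohomology ℤ ℤ ↥(E.compl.projMap ⁻¹' W) (E.vectorPartOver W) (2 * E.rank) :=
  relSingularCohomology.map ℤ ℤ
    ((ContinuousMap.snd : C(↥W × ℙ ℂ (E.F × ℂ), ℙ ℂ (E.F × ℂ))).comp
      (E.complOverHomeomorph i hK hW : C(↥(E.compl.projMap ⁻¹' W), ↥W × ℙ ℂ (E.F × ℂ))))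
    (E.mapsTo_snd_comp_complOverHomeomorph i hK hW) (2 * E.rank) (omegaRelK E.F hK' hE)

omit [T2Space B] [ParacompactSpace B] in
/-- The model relative class lifts `h^* pr₂^* ω_k`. [folklore] -/
theorem toAbsolute_modelRelComplThomClassOn (hK' : finrank ℂ E.F = E.rank) (hE : 1 ≤ E.rank) :
    relSingularCohomology.toAbsolute ℤ ℤ ↥(E.compl.projMap ⁻¹' W) (E.vectorPartOver W) (2 * E.rank)
        (E.modelRelComplThomClassOn i hK hW hK' hE) =
      singularCohomology.map ℤ ℤ (E.complOverHomeomorph i hK hW : C(↥(E.compl.projMap ⁻¹' W), ↥W × ℙ ℂ (E.F × ℂ)))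
        (2 * E.rank) (singularCohomology.map ℤ ℤ (ContinuousMap.snd : C(↥W × ℙ ℂ (E.F × ℂ), ℙ ℂ (E.F × ℂ))) (2 * E.rank)
          (omegaK E.F ℤ E.rank)) := by
  rw [modelRelComplThomClassOn, ← ModuleCat.comp_apply, relSingularCohomology.map_comp_toAbsolute, ModuleCat.comp_apply,
    toAbsolute_omegaRelK, singularCohomology.map_comp, ModuleCat.comp_apply]

omit [T2Space B] [ParacompactSpace B] in
include hK hW in
/-- **Relative lifts on `(D_W, vector part)` are unique for contractible `W`** (transport along `h`).
[cite: HatcherAT2002, §3.1 pp. 200–201] -/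
theorem toAbsolute_vectorPartOver_injective [ContractibleSpace ↥W] (hK' : finrank ℂ E.F = E.rank) (hE : 1 ≤ E.rank) :
    Injective (relSingularCohomology.toAbsolute ℤ ℤ ↥(E.compl.projMap ⁻¹' W) (E.vectorPartOver W) (2 * E.rank)) :=
  toAbsolute_injective_of_homeomorph (E.complOverHomeomorph i hK hW) (E.mapsTo_complOverHomeomorph i hK hW)
    (E.mapsTo_complOverHomeomorph_symm i hK hW) (2 * E.rank)
    (toAbsolute_prodVectorPart_injective_int E.F hK' hE ↥W)

include hKc in
/-- **The relative Thom class over a contractible trivialised `W` IS the model class**: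
`t̃_E|_{(D_W, vector part)} = (pr₂ ∘ h)^* ω_k^rel` — both lift `t_E|_{D_W} = h^* pr₂^* ω_k`, and lifts
are unique. [cite: MilnorStasheff1974, §10 Thm. 10.4] -/
theorem relComplThomClassOn_eq_model [ContractibleSpace ↥W] (hE : 0 < E.rank) :
    E.relComplThomClassOn hE W = E.modelRelComplThomClassOn i hK hW rfl hE :=
  E.toAbsolute_vectorPartOver_injective i hK hW rfl hE
    (((E.toAbsolute_relComplThomClassOn hE W).trans (E.map_projOverIncl_complThomClass i hK hKc hW)).trans
      (E.toAbsolute_modelRelComplThomClassOn i hK hW rfl hE).symm)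

/-! ### The local index in the trivialisation -/

variable (s : ∀ b, E.E b) (hs : Continuous fun b ↦ (⟨b, s b⟩ : TotalSpace E.F E.E))

omit [T2Space B] [ParacompactSpace B] in
/-- The projectivised section over `W`, with values in `D_W`. [folklore] -/
def complSectionOver (W : Set B) : C(↥W, ↥(E.compl.projMap ⁻¹' W)) where
  toFun b := ⟨E.complSection s hs b, b.2⟩
  continuous_toFun := ((E.complSection s hs).continuous.comp continuous_subtype_val).subtype_mk _

omit [T2Space B] [ParacompactSpace B] in
/-- `(D_W ↪ D) ∘ ŝ_W = ŝ ∘ (W ↪ B)`. [folklore] -/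
theorem subsetIncl_comp_complSectionOver (W : Set B) :
    (subsetIncl (E.compl.projMap ⁻¹' W)).comp (E.complSectionOver s hs W) = (E.complSection s hs).comp (subsetIncl W) := rfl

omit [T2Space B] [ParacompactSpace B] hKc in
/-- **The model section `b ↦ [e_b(s b) : 1] ∈ ℙ(F ⊕ ℂ)` over `W`**: the section read in the atlas
trivialisation `e = e_i`, as a point of the model projective space. [cite: McDuffSalamon2017, Thm. 2.7.5] -/
def modelSectionK : C(↥W, ℙ ℂ (E.F × ℂ)) :=
  ((ContinuousMap.snd : C(↥W × ℙ ℂ (E.F × ℂ), ℙ ℂ (E.F × ℂ))).comp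
    (E.complOverHomeomorph i hK hW : C(↥(E.compl.projMap ⁻¹' W), ↥W × ℙ ℂ (E.F × ℂ)))).comp (E.complSectionOver s hs W)

omit [T2Space B] [ParacompactSpace B] hKc in
/-- `modelSectionK b = [e_b(s b) : 1]`. [folklore] -/
theorem modelSectionK_apply (b : ↥W) :
    E.modelSectionK i hK hW s hs b =
      Projectivization.mk ℂ (linEquivAt ℂ E.F E.E (E.triv i) b (s b), (1 : ℂ)) (pair_one_ne_zero _) :=
  E.complOverHomeomorph_snd_mk i hK hW b.2 ((s b, (1 : ℂ)) : E.E b × ℂ) (pair_one_ne_zero _)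

omit [T2Space B] [ParacompactSpace B] hKc in
/-- Off `p` the model section is off `[0 : 1]` (inside the index domain). [folklore] -/
theorem mapsTo_modelSectionK {p : B} (hpW : p ∈ W) (hWU : W ⊆ indexDomain s p) :
    MapsTo (E.modelSectionK i hK hW s hs) ({(⟨p, hpW⟩ : ↥W)}ᶜ : Set ↥W) (modelVectorPart E.F) := by
  intro b hb
  have hb' : s b.1 ≠ 0 := by
    rcases hWU b.2 with h | h
    · exact absurd (Subtype.ext h) hb
    · exact h
  rw [E.modelSectionK_apply, mem_modelVectorPart_iff, Ne, mk_eq_zeroPt_iff]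
  exact (linEquivAt ℂ E.F E.E (E.triv i) b).map_ne_zero_iff.2 hb'

include hKc in
/-- **The local index in the trivialisation (every rank)**: for `W ∋ p` open and contractible inside
the index domain `U_p`, `W ⊆ K ⊆ U_i` with `K` closed,

  `ind_p(s) = ⟨(b ↦ [e_b(s b) : 1])^* ω_k^rel, μ_p⟩`

— the relative Kronecker pairing on `(W, W ∖ p)` of the model relative class pulled back along the
section read in the trivialisation `e_i`, with the local orientation (McDuff–Salamon: the index of a
zero is its local degree in a trivialisation; Milnor–Stasheff §9–§10). [cite: McDuffSalamon2017, Thm. 2.7.5 and Ex. 4.4.3 (v)] -/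
theorem localIndex_eq_modelSectionK [ContractibleSpace ↥W] (hE : 0 < E.rank) {n : ℕ} (hn : 2 * E.rank = n)
    (μ : HomologicalOrientation ℤ B n) {p : B} (hU : IsOpen (indexDomain s p)) (hWo : IsOpen W) (hpW : p ∈ W)
    (hWU : W ⊆ indexDomain s p) :
    E.localIndex s hs ℤ hE hn μ p =
      relKroneckerM ℤ ↥W ({(⟨p, hpW⟩ : ↥W)}ᶜ : Set ↥W) n
        (relDegCast ℤ hn (relSingularCohomology.map ℤ ℤ (E.modelSectionK i hK hW s hs)
          (E.mapsTo_modelSectionK i hK hW s hs hpW hWU) (2 * E.rank) (omegaRelK E.F rfl hE)))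
        ((localHomology.openSubsetIso ℤ ℤ hWo hpW n).inv (μ.localClass p)) := by
  subst hn
  rw [relDegCast_rfl]
  have hmaps : MapsTo (E.complSectionOver s hs W) ({(⟨p, hpW⟩ : ↥W)}ᶜ : Set ↥W) (E.vectorPartOver W) := fun b hb ↦
    mapsTo_projSection_of_subset s hs hpW hWU hb
  have hfac : relSingularCohomology.map ℤ ℤ ((E.complSection s hs).comp (subsetIncl W))
      (mapsTo_projSection_of_subset s hs hpW hWU) (2 * E.rank) (E.relComplThomClass ℤ hE) =
      relSingularCohomology.map ℤ ℤ (E.complSectionOver s hs W) hmaps (2 * E.rank) (E.relComplThomClassOn hE W) := by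
    rw [relComplThomClassOn, ← ModuleCat.comp_apply, ← relSingularCohomology.map_comp]
    rfl
  rw [E.localIndex_eq_of_subset s hs ℤ hE rfl μ p hU hWo hpW hWU, relDegCast_rfl, hfac,
    E.relComplThomClassOn_eq_model i hK hKc hW hE, modelRelComplThomClassOn, ← ModuleCat.comp_apply,
    ← relSingularCohomology.map_comp]
  rfl

/-! ### The local index through the vector model -/

omit [T2Space B] [ParacompactSpace B] hKc hW in
/-- **The vector section `b ↦ e_b(s b) ∈ F` over `W ⊆ U_i`**: the section read in the atlas
trivialisation. [cite: McDuffSalamon2017, Thm. 2.7.5] -/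
def vecSectionK (hWi : W ⊆ (E.triv i).baseSet) : C(↥W, E.F) where
  toFun b := (E.triv i ⟨b, s b⟩).2
  continuous_toFun := by
    have h2 : Continuous fun b : ↥W ↦ (⟨(b : B), s b⟩ : TotalSpace E.F E.E) := hs.comp continuous_subtype_val
    refine continuous_snd.comp (continuous_iff_continuousAt.2 fun b ↦ ?_)
    have hb : (⟨(b : B), s b⟩ : TotalSpace E.F E.E) ∈ (E.triv i).source := by
      rw [(E.triv i).source_eq]
      exact hWi b.2
    exact ContinuousAt.comp (f := fun b : ↥W ↦ (⟨(b : B), s b⟩ : TotalSpace E.F E.E)) ((E.triv i).continuousAt hb) h2.continuousAt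

omit [T2Space B] [ParacompactSpace B] hKc hW in
/-- `vecSectionK b = e_b(s b)` (through `linEquivAt`). [folklore] -/
theorem vecSectionK_apply (hWi : W ⊆ (E.triv i).baseSet) (b : ↥W) :
    E.vecSectionK i s hs hWi b = linEquivAt ℂ E.F E.E (E.triv i) b (s b) := by
  rw [linEquivAt_apply (K := ℂ) (E.triv i) (hWi b.2)]
  rfl

omit [T2Space B] [ParacompactSpace B] hKc in
/-- `[· : 1] ∘ (vector section) = model section`. [folklore] -/
theorem vecEmbed_comp_vecSectionK :
    (vecEmbed E.F).comp (E.vecSectionK i s hs (hW.trans hK)) = E.modelSectionK i hK hW s hs := by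
  ext b
  rw [ContinuousMap.comp_apply, E.modelSectionK_apply, vecEmbed_apply]
  simp_rw [E.vecSectionK_apply]

omit [T2Space B] [ParacompactSpace B] hKc hW in
/-- Off `p` the vector section is off the origin (inside the index domain). [folklore] -/
theorem mapsTo_vecSectionK (hWi : W ⊆ (E.triv i).baseSet) {p : B} (hpW : p ∈ W) (hWU : W ⊆ indexDomain s p) :
    MapsTo (E.vecSectionK i s hs hWi) ({(⟨p, hpW⟩ : ↥W)}ᶜ : Set ↥W) ({0}ᶜ : Set E.F) := by
  intro b hb
  have hb' : s b.1 ≠ 0 := by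
    rcases hWU b.2 with h | h
    · exact absurd (Subtype.ext h) hb
    · exact h
  rw [mem_compl_iff, mem_singleton_iff, E.vecSectionK_apply]
  exact (linEquivAt ℂ E.F E.E (E.triv i) b).map_ne_zero_iff.2 hb'

include hKc in
/-- **The local index through the vector model (every rank)**: for `W ∋ p` open and contractible
inside `U_p`, `W ⊆ K ⊆ U_i` with `K` closed,

  `ind_p(s) = ⟨ω_k^rel,vec, (b ↦ e_b(s b))_* μ_p⟩`

— the relative Kronecker pairing in `(F, F ∖ 0)` of the model class with the push-forward of the
local orientation along the section read in the trivialisation: McDuff–Salamon's "local degree of `s`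
at `p`" (Thm. 2.7.5, Ex. 4.4.3 (v)) in homological form. [cite: McDuffSalamon2017, Thm. 2.7.5 and Ex. 4.4.3 (v)] -/
theorem localIndex_eq_vecSectionK [ContractibleSpace ↥W] (hE : 0 < E.rank) {n : ℕ} (hn : 2 * E.rank = n)
    (μ : HomologicalOrientation ℤ B n) {p : B} (hU : IsOpen (indexDomain s p)) (hWo : IsOpen W) (hpW : p ∈ W)
    (hWU : W ⊆ indexDomain s p) :
    E.localIndex s hs ℤ hE hn μ p =
      relKroneckerM ℤ E.F ({0}ᶜ : Set E.F) n (relDegCast ℤ hn (omegaRelVecK E.F rfl hE))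
        (relativeSingularHomology.map ℤ ℤ (E.vecSectionK i s hs (hW.trans hK))
          (E.mapsTo_vecSectionK i s hs (hW.trans hK) hpW hWU) n
          ((localHomology.openSubsetIso ℤ ℤ hWo hpW n).inv (μ.localClass p))) := by
  subst hn
  rw [E.localIndex_eq_modelSectionK i hK hKc hW s hs hE rfl μ hU hWo hpW hWU, relDegCast_rfl, relDegCast_rfl,
    ← relKroneckerM_map, omegaRelVecK, ← ModuleCat.comp_apply, ← relSingularCohomology.map_comp,
    relSingularCohomology.map_congr (E.vecEmbed_comp_vecSectionK i hK hW s hs) _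
      (E.mapsTo_modelSectionK i hK hW s hs hpW hWU) (2 * E.rank)]

end OverW

end ComplexVectorBundle

end Literature.AlgebraicTopology.CharacteristicClasses

end
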